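import Summits.BirchSwinnertonDyer.BirchSwinnertonDyer.Theorems.ManinLocalTwoThreeManinPrimeToAdditiveFiveLeRedFiveTypeIIFlipTwin
import Summits.BirchSwinnertonDyer.BirchSwinnertonDyer.Theorems.ManinLocalTwoThreeManinPrimeToAdditiveFiveLeBistarredGord
import Summits.BirchSwinnertonDyer.Rank1Residual.Additive.DictionaryUniform
import Literature.NumberTheory.EllipticCurves.NeronLocalHeightCompletion
import HarnessLib

/-!
# Route `ManinLocalTwoThree`, residual crux C5 `ManinPrimeToAdditiveFiveLe`
# (stmt-BirchSwinnertonDyer-22969), line `upper_anchor` (skeleton v7, registered stub `stub_typeIIAtFiveCorner`):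
# **the «starred twin» corner of the Kodaira-II cell at 5 is EMPTY under ONE Manin-free, degree-free law —
# «optimal ⟹ unstarred» on the potentially supersingular `W[p]`-reducible locus at `p ∈ {5, 7}`**

Lead seat bsd-line-ml23-c5-p1 (gen 4), integrating the width seat's λ (p621355, `…BistarredGord.lean`).
After gen 4's p622240 (`…RedFiveTypeIIFlipTwin.lean`) and the width seat's p621355 the `W[p]`-reducible residue
RED(57♯) of C5 has exactly TWO «corner» stubs, both of the shape «the X₀(N)-optimal curve is the STARRED member
of a mixed-type twin pair»: the bi-starred corner (`stub_red57bistarred`, starred `W` all of whose optimal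
`χ_{p*}`-partners are starred; by p621355 §1 only its NON-(G)-ordinary half survives Dokchitser–Dokchitser 2015)
and CORNER(5; II) (`stub_typeIIAtFiveCorner`: a type-II `W[5]`-reducible optimal `W` all of whose optimal
`χ₅`-partners are starred). The width seat typed the Manin-free law killing the first (p621355 §2, hypothesis
`hU`, census 0 / 2 268 at `p = 5`, 0 / ≈ 490 at `p = 7`):

  (U)  `W/ℚ` globally minimal with a LATTICE-OPTIMAL conductor-level datum, `p ∈ {5, 7}`, `p² ∣ N(W) > 5·10⁵`,
       globally twist-minimal, `W[p]` reducible, no `Iₙ*` fibre at `p`, NOT (G)-ordinary at `p`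
       ⟹ `ord_p Δ_min(W) ≤ 4` (Kodaira II/III/IV).

THIS FILE proves that (U) — in the DEGREE-FREE form `hU` below (p621355's `hU` without its idle binder
`p ∣ deg φ`; still 0 exceptions in range, the census counts all optimal curves) — ALSO empties CORNER(5; II):

* `cornerTypeIIAtFive_of_optimalUnstarredNonGord` — **(U) ⟹ `stub_typeIIAtFiveCorner` VERBATIM.**

PROOF. Let `W` be of type II at `5` (`ord₅ Δ_min = 2`) with the cuts and suppose every lattice-optimal
globally minimal `W₀ ∼ W ⊗ 5` is starred; pick one (modularity, `exists_isIsogenous_latticeOptimal`). As in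
p622240: `W ∼ W₀ ⊗ 5`, `25 ∣ N(W₀) = N(W)`, the cuts transfer to `W₀`. The globally minimal model `C` of `W ⊗ 5`
has `ord₅ Δ_min(C) = 2 + 6 = 8` and `C ∼ W₀`; the globally minimal model `C′` of `W₀ ⊗ 5` is isogenous to `W`,
hence additive at `5`, so `ord₅ j(W₀) ≥ 0` (`padicValRat_j_nonneg_of_pStar_pair_addv`). The PROVED tame-index
isogeny invariance (`TameDefectIsogenyInvariance.gcd_padicValInt_minimalDiscriminantInt_eq_of_isIsogenous`)
gives `gcd(12, ord₅ Δ_min(W₀)) = gcd(12, 8) = 4`, so (Tate's table at an additive `p ≥ 5` with integral `j`)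
`W₀` is of type IV*: `ord₅ Δ_min(W₀) = 8`, tame index `e = 12/4 = 3 ∤ 5 − 1`. By the cell's uniform dictionary
(`subGord_iff_typeG_of_addv`: (G) ⟺ `e ∣ p − 1`) `W₀` is not (G), a fortiori not (G)-ordinary. Now (U) applied
to `(W₀, D₀)` says `ord₅ Δ_min(W₀) ≤ 4` — contradiction. So the corner is EMPTY under (U), and the stub holds.

CONSEQUENCE FOR THE SKELETON (v8, lead gen 4): BOTH corners of RED(57♯) are carried by the single Manin-free,
degree-free law (U) (+ Dokchitser–Dokchitser 2015 Thm. 5.1 (1) for the (G)-ordinary half of the bi-starred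
corner, a cite-only tree fact); the `W[p]`-reducible residue of C5 at `p ∈ {5, 7}` then reads
RED(57♯) ⟸ ČNS ∧ D–D ∧ RED(57♯)[unstarred, off (5; II)] ∧ (U). Census law behind (U) (HOME data/TWISTCENSUS2,
N ≤ 5·10⁵): on the potentially supersingular reducible locus the optimal curve is ALWAYS the unstarred member
(p = 5: 771 + 771 flip rows II ↔ IV, 0 optimal IV*/II*; p = 7: 122 flip rows III → III, 0 optimal III* outside
the (G)-ordinary classes). (U) is conjecture-shaped (Stevens-type minimality: the unstarred `p`-isogenous partner
has Faltings height smaller by `½ log p`, Gealy–Klagsbrun 2017); NOT asserted here.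

HONEST STATUS. Conditional result (`--supports`, helper) between OPEN statements; no printed input. Nothing here
proves `stub_typeIIAtFiveCorner`, C5, Manin's conjecture or BSD.

References: [Stevens1989] §2; [GealyKlagsbrun2017] Thm. 1; [DokchitserDokchitser2015LocalInvariants] Thm. 5.1,
Cor. 3.3; [SerreTate1968] §2 Cor. 3; [SilvermanATAEC1994] IV Table 4.1; [Delbourgo1998] §1.5 (hypothesis (G)).
-/

set_option autoImplicit false
-- the Theorems namespace of this sub repeats the summit name by design (D-0017 nested layout)
set_option linter.dupNamespace false

noncomputable section

open scoped Classical NumberField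

namespace Summit.BirchSwinnertonDyer.BirchSwinnertonDyer.Theorems

open WeierstrassCurve IsDedekindDomain IsDedekindDomain.HeightOneSpectrum Rat.HeightOneSpectrum NumberField
  Literature.NumberTheory.EllipticCurves Literature.NumberTheory.EllipticCurves.ModularForms
  Literature.NumberTheory.EllipticCurves.Rank1Residual
  Literature.NumberTheory.DiophantineGeometry
  Summit.BirchSwinnertonDyer.Rank1Residual.ManinAdditive
  Summit.BirchSwinnertonDyer.Rank1Residual.Additive

/-- **CORNER(5; II) (= registered `stub_typeIIAtFiveCorner` of skeleton v7, VERBATIM as the conclusion) is EMPTY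
under the Manin-free, degree-free law (U) «optimal ⟹ unstarred on the non-(G)-ordinary `W[p]`-reducible locus at
`p ∈ {5, 7}`» (`hU` = the width seat's `hU` of p621355 §2 without its `p ∣ deg φ` binder).** Proof in the module
docstring: the starred optimal twin `W₀ ∼ W ⊗ 5` of a type-II curve is of type IV* (tame index 3) by the PROVED
tame-index isogeny invariance, hence not (G) by the uniform dictionary, and (U) forbids it. Conditional result
between OPEN statements; nothing here proves C5. [cite: Stevens1989, §2] [cite: SilvermanATAEC1994, IV Table 4.1]
[cite: SerreTate1968, §2 Cor. 3] [cite: Delbourgo1998, §1.5] -/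
theorem cornerTypeIIAtFive_of_optimalUnstarredNonGord
    (hU : exists_isNewformOf →
      ∀ (W : WeierstrassCurve ℚ) [W.IsElliptic] [W.IsGloballyMinimal] [NeZero (W.conductorNorm ℤ)]
        (D : ModularParametrizationData W (W.conductorNorm ℤ)),
        IsLatticeOptimal D → ∀ (p : ℕ) (hp : p.Prime), (p = 5 ∨ p = 7) → p ^ 2 ∣ W.conductorNorm ℤ →
        ¬ (∃ (W' : WeierstrassCurve ℚ) (q : ℕ), W'.IsElliptic ∧ W'.IsGloballyMinimal ∧ q.Prime ∧
            q ≠ 2 ∧ q ^ 2 ∣ W.conductorNorm ℤ ∧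
            IsIsogenous W (W'.quadraticTwist (((-1 : ℤ) ^ (q / 2) * q : ℤ) : ℚ)) ∧
            ¬ q ^ 2 ∣ W'.conductorNorm ℤ) →
        ¬ (∃ (W' : WeierstrassCurve ℚ) (d : ℤ), W'.IsElliptic ∧ W'.IsGloballyMinimal ∧
            (d = -1 ∨ d = 2 ∨ d = -2) ∧ 2 ^ 2 ∣ W.conductorNorm ℤ ∧
            IsIsogenous W (W'.quadraticTwist (d : ℚ)) ∧ ¬ 2 ^ 2 ∣ W'.conductorNorm ℤ) →
        ¬ W.HasIrreducibleModPGaloisRep p →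
        500000 < W.conductorNorm ℤ →
        (∀ n : ℕ, W.kodairaSymbolAt ((Rat.HeightOneSpectrum.primesEquiv (R := ℤ)).symm ⟨p, hp⟩) ≠
          .Istar n) →
        ¬ TypeGOrd W p →
        padicValInt p W.minimalDiscriminantInt ≤ 4) :
    mazur_not_dvd_maninConstant_of_odd → abbesUllmo_not_dvd_maninConstant_of_not_dvd_level →
    cesnavicius_not_two_dvd_maninConstant_of_two_dvd_level → exists_isNewformOf →
    ∀ (W : WeierstrassCurve ℚ) [W.IsElliptic] [W.IsGloballyMinimal] [NeZero (W.conductorNorm ℤ)]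
      (D : ModularParametrizationData W (W.conductorNorm ℤ)),
      IsLatticeOptimal D → ∀ (p : ℕ) (hp : p.Prime), (p = 5 ∨ p = 7) → p ^ 2 ∣ W.conductorNorm ℤ →
      ¬ (∃ (W' : WeierstrassCurve ℚ) (q : ℕ), W'.IsElliptic ∧ W'.IsGloballyMinimal ∧ q.Prime ∧
          q ≠ 2 ∧ q ^ 2 ∣ W.conductorNorm ℤ ∧
          IsIsogenous W (W'.quadraticTwist (((-1 : ℤ) ^ (q / 2) * q : ℤ) : ℚ)) ∧
          ¬ q ^ 2 ∣ W'.conductorNorm ℤ) →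
      ¬ (∃ (W' : WeierstrassCurve ℚ) (d : ℤ), W'.IsElliptic ∧ W'.IsGloballyMinimal ∧
          (d = -1 ∨ d = 2 ∨ d = -2) ∧ 2 ^ 2 ∣ W.conductorNorm ℤ ∧
          IsIsogenous W (W'.quadraticTwist (d : ℚ)) ∧ ¬ 2 ^ 2 ∣ W'.conductorNorm ℤ) →
      ¬ W.HasIrreducibleModPGaloisRep p →
      500000 < W.conductorNorm ℤ →
      p ∣ D.modularDegree →
      (∀ n : ℕ, W.kodairaSymbolAt ((Rat.HeightOneSpectrum.primesEquiv (R := ℤ)).symm ⟨p, hp⟩) ≠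
        .Istar n) →
      padicValInt p W.minimalDiscriminantInt ≤ 4 →
      p = 5 → padicValInt p W.minimalDiscriminantInt = 2 →
      (∀ (W₀ : WeierstrassCurve ℚ) [W₀.IsElliptic] [W₀.IsGloballyMinimal] [NeZero (W₀.conductorNorm ℤ)]
          (D₀ : ModularParametrizationData W₀ (W₀.conductorNorm ℤ)), IsLatticeOptimal D₀ →
          IsIsogenous (W.quadraticTwist ((((-1 : ℤ) ^ (p / 2) * p : ℤ)) : ℚ)) W₀ →
          4 < padicValInt p W₀.minimalDiscriminantInt) →
      ¬ (p : ℤ) ∣ D.maninConstant := by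
  intro _hM _hAU _hC hnf W _ _ _ D _hD p hp h57 hpN hodd hdy hred hN _hdeg _hI _hv hp5 hv2 hall
  haveI hpF : Fact p.Prime := ⟨hp⟩
  have h5 : 5 ≤ p := by omega
  have hp2 : p ≠ 2 := by omega
  obtain ⟨-, hd⟩ := pStar_intCast p
  have hd0 : ((((-1 : ℤ) ^ (p / 2) * p : ℤ)) : ℚ) ≠ 0 := by
    push_cast
    exact mul_ne_zero (pow_ne_zero _ (by norm_num)) (by exact_mod_cast hp.ne_zero)
  haveI : (W.quadraticTwist ((((-1 : ℤ) ^ (p / 2) * p : ℤ)) : ℚ)).IsElliptic := W.isElliptic_quadraticTwist hd0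
  -- the (starred) lattice-optimal curve `W₀` of the class of `W ⊗ p*`
  obtain ⟨W₀, hE₀, hM₀, hne₀, D₀, hD₀, hiso⟩ :=
    exists_isIsogenous_latticeOptimal hnf (W.quadraticTwist ((((-1 : ℤ) ^ (p / 2) * p : ℤ)) : ℚ))
  haveI := hE₀
  haveI := hM₀
  haveI := hne₀
  have hv₀ : 4 < padicValInt p W₀.minimalDiscriminantInt := hall W₀ D₀ hD₀ hiso
  haveI : (W₀.quadraticTwist ((((-1 : ℤ) ^ (p / 2) * p : ℤ)) : ℚ)).IsElliptic := W₀.isElliptic_quadraticTwist hd0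
  haveI : ((W.quadraticTwist ((((-1 : ℤ) ^ (p / 2) * p : ℤ)) : ℚ)).quadraticTwist
      ((((-1 : ℤ) ^ (p / 2) * p : ℤ)) : ℚ)).IsElliptic :=
    (W.quadraticTwist ((((-1 : ℤ) ^ (p / 2) * p : ℤ)) : ℚ)).isElliptic_quadraticTwist hd0
  -- `W ∼ W₀ ⊗ p*`
  have htw : IsIsogenous W (W₀.quadraticTwist ((((-1 : ℤ) ^ (p / 2) * p : ℤ)) : ℚ)) := by
    obtain ⟨Cq, hCq⟩ := W.exists_variableChange_smul_eq_quadraticTwist_sq hd0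
    have h1 : IsIsogenous W ((W.quadraticTwist ((((-1 : ℤ) ^ (p / 2) * p : ℤ)) : ℚ)).quadraticTwist
        ((((-1 : ℤ) ^ (p / 2) * p : ℤ)) : ℚ)) := by
      rw [quadraticTwist_quadraticTwist, ← sq, ← hCq]
      exact isIsogenous_smul _ _
    exact h1.trans' (hiso.quadraticTwist hd0)
  -- twist-minimality of `W` at `p`: `p² ∣ N(W₀)`; hence `N(W₀) = N(W)`
  have hpN₀ : p ^ 2 ∣ W₀.conductorNorm ℤ := by
    by_contra h
    exact hodd ⟨W₀, p, hE₀, hM₀, hp, hp2, hpN, htw, h⟩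
  have hNN : W₀.conductorNorm ℤ = W.conductorNorm ℤ :=
    conductorNorm_eq_of_isIsogenous_twist_pStar_of_sq_dvd hnf h5 htw hpN hpN₀
  have hadd₀ : Addv W₀ p := not_good_and_not_mult_of_sq_dvd_conductorNorm W₀ hpN₀
  -- globally minimal models `C` of `W ⊗ p*` (`∼ W₀`) and `C'` of `W₀ ⊗ p*` (`∼ W`)
  obtain ⟨u, hCmin⟩ := hasGlobalMinimalModel_rat_holds (W.quadraticTwist ((((-1 : ℤ) ^ (p / 2) * p : ℤ)) : ℚ))
  set C : WeierstrassCurve ℚ := u • W.quadraticTwist ((((-1 : ℤ) ^ (p / 2) * p : ℤ)) : ℚ) with hCdef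
  haveI : C.IsGloballyMinimal := hCmin
  obtain ⟨u', hC'min⟩ := hasGlobalMinimalModel_rat_holds (W₀.quadraticTwist ((((-1 : ℤ) ^ (p / 2) * p : ℤ)) : ℚ))
  set C' : WeierstrassCurve ℚ := u' • W₀.quadraticTwist ((((-1 : ℤ) ^ (p / 2) * p : ℤ)) : ℚ) with hC'def
  haveI : C'.IsGloballyMinimal := hC'min
  have hCW₀ : IsIsogenous C W₀ :=
    (isIsogenous_smul (W.quadraticTwist ((((-1 : ℤ) ^ (p / 2) * p : ℤ)) : ℚ)) u).symm_of_charZero.trans' hiso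
  have hC'W : IsIsogenous C' W :=
    (htw.trans' (isIsogenous_smul (W₀.quadraticTwist ((((-1 : ℤ) ^ (p / 2) * p : ℤ)) : ℚ)) u')).symm_of_charZero
  -- `C'` is additive at `p` (same conductor as `W`), so `ord_p j(W₀) ≥ 0`
  have hAddC' : Addv C' p := by
    have hNC' : C'.conductorNorm ℤ = W.conductorNorm ℤ :=
      conductorNorm_eq_of_isIsogenous_of_modularity
        (nonempty_modularParametrizationData_of_exists_isNewformOf hnf
          IsNewformOf.exists_maninConstant_ne_zero_holds) _ _ hC'W
    exact not_good_and_not_mult_of_sq_dvd_conductorNorm C' (by rw [hNC']; exact hpN)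
  have hj₀ : 0 ≤ padicValRat p W₀.j := padicValRat_j_nonneg_of_pStar_pair_addv hp2 u' rfl hadd₀ hAddC'
  -- `ord_p Δ_min(C) = ord_p Δ_min(W) + 6 = 8`
  have hv6 : padicValInt p W.minimalDiscriminantInt < 6 := by omega
  have hvC : padicValInt p C.minimalDiscriminantInt = padicValInt p W.minimalDiscriminantInt + 6 :=
    padicValInt_minimalDiscriminantInt_twist_pm_p_of_lt_six p hp2 W C hv6 hd u rfl
  -- tame-index invariance along `W₀ ∼ C`: `gcd(12, 8) = gcd(12, ord_p Δ_min(W₀))`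
  have hgcd := TameDefectIsogenyInvariance.gcd_padicValInt_minimalDiscriminantInt_eq_of_isIsogenous
    (W := W₀) (W' := C) h5 hj₀ hCW₀.symm_of_charZero
  rw [hvC, hv2] at hgcd
  -- hence `ord_p Δ_min(W₀) ≠ 6`, no `Iₙ*` fibre, and in fact `ord_p Δ_min(W₀) = 8` (type IV*)
  have h6 : padicValInt p W₀.minimalDiscriminantInt ≠ 6 := by
    intro h; rw [h] at hgcd; norm_num at hgcd
  -- no `Iₙ*` fibre for `W₀`: `n = 0` would give `ord_p Δ_min = 6`; `n ≥ 1` would give `ord_p j < 0`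
  -- (Tate's table, `one_lt_valuation_j_of_kodairaSymbolAt_eq_Istar_succ` read through the `p`-adic valuation)
  have hI₀ : ∀ n : ℕ,
      W₀.kodairaSymbolAt ((Rat.HeightOneSpectrum.primesEquiv (R := ℤ)).symm ⟨p, hp⟩) ≠ .Istar n := by
    intro n hK
    have hK' : W₀.kodairaSymbolAt (placeOf p) = .Istar n := hK
    cases n with
    | zero =>
      have h := padicValInt_minimalDiscriminantInt_eq_numComponents_add_one W₀ p h5 hadd₀
      rw [hK', KodairaSymbol.numComponents_Istar] at h
      exact h6 (by omega)
    | succ k =>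
      haveI : PerfectField (IsLocalRing.ResidueField ((placeOf p).adicCompletionIntegers ℚ)) :=
        PerfectField.ofFinite
      have hchar : ringChar (ℤ ⧸ (placeOf p).asIdeal) ≠ 2 := by
        rw [ringChar_int_quot_placeOf p]; omega
      have h1 := one_lt_valuation_j_of_kodairaSymbolAt_eq_Istar_succ (placeOf p) W₀ hchar hK'
      have hj0 : W₀.j ≠ 0 := by
        intro h0
        rw [h0, map_zero] at h1
        exact not_lt.mpr zero_le_one h1
      have hgen : natGenerator (placeOf p) = p :=
        congrArg Subtype.val ((primesEquiv (R := ℤ)).apply_symm_apply ⟨p, hp⟩)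
      rw [Rat.HeightOneSpectrum.valuation_eq_exp_neg_padicValRat (placeOf p) hj0,
        hgen, ← WithZero.exp_zero, WithZero.exp_lt_exp] at h1
      linarith
  have hv₀8 : padicValInt p W₀.minimalDiscriminantInt = 8 := by
    rcases kodairaSymbolAt_placeOf_cases_of_addv W₀ p h5 hadd₀ with
      ⟨-, h⟩ | ⟨-, h⟩ | ⟨-, h⟩ | ⟨m, hm, -⟩ | ⟨-, h⟩ | ⟨-, h⟩ | ⟨-, h⟩
    · omega
    · omega
    · omega
    · exact absurd hm (hI₀ m)
    · exact h
    · rw [h] at hgcd; norm_num at hgcd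
    · rw [h] at hgcd; norm_num at hgcd
  -- `W₀` is not (G): tame index `12 / gcd(12, 8) = 3 ∤ p − 1 = 4`
  have hnotG : ¬ TypeGOrd W₀ p := by
    intro hG
    have hS : SubGord W₀ p := (subGord_iff_typeG_of_addv W₀ p hp2 hadd₀).mpr hG.typeG
    obtain ⟨-, -, hdvd⟩ := hS
    unfold semistabilityIndex at hdvd
    rw [hv₀8, hp5] at hdvd
    norm_num at hdvd
  -- (U) on `(W₀, D₀)`: `ord_p Δ_min(W₀) ≤ 4` — contradiction with `4 < ord_p Δ_min(W₀)`
  have hred₀ : ¬ W₀.HasIrreducibleModPGaloisRep p := fun h ↦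
    not_hasIrreducibleModPGaloisRep_of_isIsogenous htw hred
      ((hasIrreducibleModPGaloisRep_quadraticTwist_iff W₀ hd0 p).mpr h)
  have hle := hU hnf W₀ D₀ hD₀ p hp h57 hpN₀
    (oddTwistMinimal_of_isIsogenous_twist_pStar hnf hp2 htw hpN hNN hodd)
    (dyadicTwistMinimal_of_isIsogenous_twist_pStar hp2 htw hNN hdy)
    hred₀ (by rw [hNN]; exact hN) hI₀ hnotG
  intro _
  omega

end Summit.BirchSwinnertonDyer.BirchSwinnertonDyer.Theorems

end
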